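import Summits.CriticalPhenomena.SAWScalingLimit.Theorems.SAWRenewalTightnessTubeLowerBoundDefs
import Literature.Probability.RandomPlanarGeometry.SAWBridges

/-!
# Sketch — crux idea `profile-potential` (crux `TubeLowerBound`, stmt-CriticalPhenomena-4730; round 2, ideator 4)

Potential-weighted Simon–Lieb in a WEDGE: the first-exit cut run inside the quadrant (resp. the half-plane)
from its corner (resp. a wall point), with the position-dependent near-critical susceptibility as the weight.
Typed here: the objects, the two transfer inputs of each variant, the first lemma (a length-by-length cut
inequality, provable now), and the two compositions the line would have to glue.  Everything is a finite
combinatorial statement except the `HasSum` clauses of the profile bounds.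
-/

noncomputable section

namespace Summit.CriticalPhenomena.SAWScalingLimit.Cruxes.TubeLowerBound.Ideator4

open scoped BigOperators Classical
open Literature.Probability.LatticeModels
open Literature.Probability.RandomPlanarGeometry Literature.Probability.RandomPlanarGeometry.SAW
open Summit.CriticalPhenomena.SAWScalingLimit.Theorems.TubeLowerBound.LiebSimonStar (CornerCrossingFloor)
open Summit.CriticalPhenomena.SAWScalingLimit.Theses.SAWRenewalTightness (TubeLowerBound)

/-! ### Quadrant variant (V2): corner start, square inner set, diagonal symmetry -/

/-- `n`-step SAWs from `0` all of whose vertices lie in the shifted quadrant `{x ≥ -a, y ≥ -a}`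
(`a = 0`: the corner-started quadrant walks `q_n`; `a = t`: the walks "from the diagonal point `(t,t)`"). -/
def quadWalks (a : ℕ) (n : ℕ) : Finset (ℕ → Site 2) :=
  (Zd.saws 2 n).filter (fun ω => ∀ i ≤ n, -(a : ℤ) ≤ ω i 0 ∧ -(a : ℤ) ≤ ω i 1)

/-- Corner-started walks that stay in the closed square `[0,R]²` for `i < n` and whose `n`-th vertex is their
first visit of the column `x = R+1` (east first-exit prefixes of the square; `n`-th vertex `(R+1, y)`, `0 ≤ y ≤ R`). -/
def cornerExitEast (R : ℕ) (n : ℕ) : Finset (ℕ → Site 2) :=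
  (Zd.saws 2 n).filter (fun ω => (∀ i < n, 0 ≤ ω i 0 ∧ ω i 0 ≤ (R : ℤ) ∧ 0 ≤ ω i 1 ∧ ω i 1 ≤ (R : ℤ)) ∧
    ω n 0 = (R : ℤ) + 1 ∧ 0 ≤ ω n 1)

/-- Corner-started walks staying in the closed square `[0,R]²` for all `i ≤ n` (empty once `n ≥ (R+1)²`). -/
def squareWalks (R : ℕ) (n : ℕ) : Finset (ℕ → Site 2) :=
  (Zd.saws 2 n).filter (fun ω => ∀ i ≤ n, 0 ≤ ω i 0 ∧ ω i 0 ≤ (R : ℤ) ∧ 0 ≤ ω i 1 ∧ ω i 1 ≤ (R : ℤ))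

/-- **First lemma (quadrant cut, length by length; provable now, M).**  Cut a corner-started quadrant walk at its
first exit from `[0,R]²`: it exits through the east side or the north side (the two classes are exchanged by the
diagonal reflection `(x,y) ↦ (y,x)`, which preserves `Zd.saws`), the prefix is an element of `cornerExitEast R k`
(or its mirror), the suffix is an `(n-k)`-step walk from the exit point `(R+1, y)` staying in the quadrant, i.e.
(translated) an element of `quadWalks`-type class for the corner `(-(R+1), -y) `, contained in `quadWalks (R+1) (n-k)`
by monotonicity in the corner.  Toy-checked by exact enumeration for `R ≤ 3`, `n ≤ 22` (folder `toy/cutcheck.py`). -/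
theorem quadrantCut (R n : ℕ) :
    ((quadWalks 0 n).card : ℝ) ≤ (squareWalks R n).card +
      2 * ∑ k ∈ Finset.range (n + 1), ((cornerExitEast R k).card : ℝ) * (quadWalks (R + 1) (n - k)).card := by
  sorry

/-- **Input (V2a) `QuadrantDivergence`** — the corner susceptibility of the critical quadrant SAW is infinite:
`Σ_n q_n x_c^n = ∞` (partial sums unbounded).  Qualitative; predicted `q_n x_c^n ≍ n^{γ(π/2) - 1} = n^{-33/64}`
(Cardy's wedge exponent, `γ(π/2) = 31/64 > 0`); toy: `q_n x_c^n · n^{33/64} → 1.23` for `n ≤ 22`.  OPEN. -/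
def QuadrantDivergence : Prop :=
  ∀ M : ℝ, ∃ N : ℕ, M ≤ ∑ n ∈ Finset.range (N + 1), ((quadWalks 0 n).card : ℝ) * criticalFugacity ^ n

/-- **Input (V2b) `QuadrantProfileBound`** — moving the corner diagonally away by `R+1` multiplies the
near-critical quadrant susceptibility by at most a polynomial in `R`, for fugacities arbitrarily close to `x_c`
(liminf form — all the composition uses): `liminf_{x↑x_c} χ^Q_x[(R+1,R+1)]/χ^Q_x[(0,0)] ≤ C (R+2)^C`.  A RATIO CEILING; predicted ratio `≍ R^{x_c(π/2) - x_1} = R^{55/48}`;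
toy: `lim_n q_n^{(t,t)}/q_n^{(0,0)} = 2.09, 3.19, 4.28, 5.39, 7.8, 10.4` (`t = 1..6,8`), local exponent `↗ 1`.  OPEN. -/
def QuadrantProfileBound : Prop :=
  ∃ C : ℝ, 0 ≤ C ∧ ∀ R : ℕ, ∀ x₀ : ℝ, x₀ < criticalFugacity → ∃ x : ℝ, x₀ < x ∧ 0 ≤ x ∧ x < criticalFugacity ∧
    ∃ S S₀ : ℝ, HasSum (fun n => ((quadWalks (R + 1) n).card : ℝ) * x ^ n) S ∧
      HasSum (fun n => ((quadWalks 0 n).card : ℝ) * x ^ n) S₀ ∧ S ≤ C * ((R : ℝ) + 2) ^ C * S₀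

/-- **Fugacity-free form (C⁺⁺) `CountProfileBound`** — the same ratio for COUNTS of one length, for all large `n`:
`q_n^{(R+1,R+1)} ≤ C (R+2)^C q_n^{(0,0)}` for `n ≥ n₀(R)` ("an n-step SAW in the quadrant cornered `R+1` below-left of
its start stays in the quadrant cornered AT its start with probability `≥ R^{-C}/C`, for all long walks").  Under
`QuadrantDivergence` it implies `QuadrantProfileBound` (a finite initial segment of the series is negligible against
a divergent one); `n₀(R)` is free, so no by-length corner floor is hidden in it.  OPEN. -/
def CountProfileBound : Prop :=
  ∃ C : ℝ, 0 ≤ C ∧ ∀ R : ℕ, ∃ n₀ : ℕ, ∀ n ≥ n₀,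
    ((quadWalks (R + 1) n).card : ℝ) ≤ C * ((R : ℝ) + 2) ^ C * (quadWalks 0 n).card

/-- `QuadrantDivergence → CountProfileBound → QuadrantProfileBound` (provable now, S–M: split the series at `n₀`). -/
theorem quadrantProfileBound_of_count : QuadrantDivergence → CountProfileBound → QuadrantProfileBound := by
  sorry

/-- **Composition (V2), provable now given `quadrantCut` (M):** sum the cut with weights `x^n`, divide by the
divergent corner susceptibility, use the profile bound and the symmetry factor `2`: the east first-exit mass of
the square from its corner is `≥ (3/(8C)) (R+2)^{-C}` at some `x < x_c`, hence at `x_c`; these prefixes belong to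
`CornerCrossingFloor`'s family with `a = R+1`, `K = 1` (and `N = (R+1)² + 1`). -/
theorem cornerCrossingFloor_of_quadrant :
    QuadrantDivergence → QuadrantProfileBound → CornerCrossingFloor := by
  sorry

/-- … and the crux follows by the LANDED chain of the line `lieb-simon-star`
(`stub_steeredChain`, `stub_mirrorPin`, `stub_cornerStaircase`, `stub_octantReduction`, `tightTubeFloor_iff_crux`). -/
theorem tubeLowerBound_of_quadrant :
    QuadrantDivergence → QuadrantProfileBound → TubeLowerBound := by
  sorry

/-! ### Half-plane variant (V1): wall point, slab inner set, one exit class — the milestone `SpanRenewalFloor` -/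

/-- `n`-step SAWs from `0` all of whose vertices satisfy `x ≥ -t` (weak half-plane walks "from depth `t`"). -/
def hpWalks (t : ℕ) (n : ℕ) : Finset (ℕ → Site 2) :=
  (Zd.saws 2 n).filter (fun ω => ∀ i ≤ n, -(t : ℤ) ≤ ω i 0)

/-- Walks from the wall point staying in the slab `0 ≤ x ≤ R` for all `i ≤ n`. -/
def slabWalks (R : ℕ) (n : ℕ) : Finset (ℕ → Site 2) :=
  (Zd.saws 2 n).filter (fun ω => ∀ i ≤ n, 0 ≤ ω i 0 ∧ ω i 0 ≤ (R : ℤ))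

/-- Weak bridges of span `R+1` from the wall point: in the slab `[0,R]` for `i < n`, `n`-th vertex on `x = R+1`. -/
def weakBridges (R : ℕ) (n : ℕ) : Finset (ℕ → Site 2) :=
  (Zd.saws 2 n).filter (fun ω => (∀ i < n, 0 ≤ ω i 0 ∧ ω i 0 ≤ (R : ℤ)) ∧ ω n 0 = (R : ℤ) + 1)

/-- **Half-plane cut (provable now, M):** `h̃_n ≤ sl_n + Σ_k w_k h̃^{(R+1)}_{n-k}` (first hit of column `R+1`). -/
theorem halfPlaneCut (R n : ℕ) :
    ((hpWalks 0 n).card : ℝ) ≤ (slabWalks R n).card +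
      ∑ k ∈ Finset.range (n + 1), ((weakBridges R k).card : ℝ) * (hpWalks (R + 1) (n - k)).card := by
  sorry

/-- **Input (V1a) `SlabSubcritical`** — a slab of fixed width is subcritical at `x_c` (Kesten's pattern theorem /
strict monotonicity of strip connective constants; classical, not yet in tree for axis slabs of width ≥ 3). -/
def SlabSubcritical : Prop :=
  ∀ R : ℕ, Summable (fun n => ((slabWalks R n).card : ℝ) * criticalFugacity ^ n)

/-- **Input (V1b) `ProfileBound`** — the near-critical half-plane susceptibility profile grows polynomially in the
distance to the wall (liminf form): `liminf_{x↑x_c} χ^ℍ_x[t]/χ^ℍ_x[0] ≤ C (t+1)^C`.  Predicted `≍ t^{x_s - x_1} = t^{25/48}`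
(concave!); toy: `lim_n h̃_n^{(t)}/h̃_n^{(0)} = 1.40, 1.73, 2.01, 2.27, 2.74, 3.14` (`t = 1,2,3,4,6,8`).  OPEN. -/
def ProfileBound : Prop :=
  ∃ C : ℝ, 0 ≤ C ∧ ∀ t : ℕ, ∀ x₀ : ℝ, x₀ < criticalFugacity → ∃ x : ℝ, x₀ < x ∧ 0 ≤ x ∧ x < criticalFugacity ∧
    ∃ S S₀ : ℝ, HasSum (fun n => ((hpWalks t n).card : ℝ) * x ^ n) S ∧
      HasSum (fun n => ((hpWalks 0 n).card : ℝ) * x ^ n) S₀ ∧ S ≤ C * ((t : ℝ) + 1) ^ C * S₀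

/-- **Composition (V1), provable now given `halfPlaneCut` + divergence of `Σ h̃_n x_c^n` (tree:
`count_le_sum_halfSpaceCount`, `pow_connectiveConstant_le_count`):** the weak-bridge span mass is `≥ 1/ρ(R+1)`,
and prepending one east step gives Kesten's span-renewal floor in the vertex form of the sibling lines. -/
theorem spanRenewalFloor_of_profileBound :
    SlabSubcritical → ProfileBound →
      ∃ C c : ℝ, 0 ≤ C ∧ 0 < c ∧ ∀ L : ℕ, 1 ≤ L → ∃ N : ℕ, c * (L : ℝ) ^ (-C) ≤
        ∑ n ∈ Finset.range (N + 1), ∑ _ω ∈ (Zd.bridges 2 n).filter (fun ω => ω n 0 = (L : ℤ)),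
          criticalFugacity ^ n := by
  sorry

/-- **By-product ceiling (provable now, S):** the future of every east prefix contains a translate of the corner
class (`φ ≥ 1`), so the cut read the other way bounds the corner east-exit mass of every square by `1/2`
(toy: `0.379, 0.273, 0.213, 0.175` for `R = 0..3`). -/
theorem cornerExitEast_mass_le_half (R : ℕ) (N : ℕ) :
    ∑ n ∈ Finset.range (N + 1), ((cornerExitEast R n).card : ℝ) * criticalFugacity ^ n ≤ 1 / 2 := by
  sorry

end Summit.CriticalPhenomena.SAWScalingLimit.Cruxes.TubeLowerBound.Ideator4

end
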